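import Mathlib
import HarnessLib

/-!
# RH for an `L`-polynomial ⟺ `|∑ᵢ αᵢⁿ| ≤ 2g q^{n/2}` for all `n` (Omar–Bouanani 2010, Thm. 2)

Topic `NumberTheory/LFunctions` (zeta functions of function fields / curves over finite fields);
**proof file**: theorems only, no named facts (D-0014, D-0026).

Let `K/𝔽_q` be a function field of genus `g` with zeta function `Z_K(T) = L(T)/((1-T)(1-qT))`,
`L(T) = ∑_{i ≤ 2g} aᵢ Tⁱ = ∏_{i=1}^{2g} (1 - αᵢ T)`, `a₀ = 1`, `a_{2g} = q^g` (Omar–Bouanani, eqs.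
(4)–(7)).  Writing `log L(T) = ∑_{n ≥ 1} λ_K(n) Tⁿ/n`, i.e. `λ_K(n) = -∑ᵢ αᵢⁿ` (eq. (13); the
letter `λ_K` is re-used there for this second sequence), **Theorem 2** of the paper says:
the zeros of `ζ_K(s) = Z_K(q^{-s})` lie on `Re s = 1/2` (equivalently `|αᵢ| = q^{1/2}` for all `i`)
**iff** `|λ_K(n)| ≤ 2g q^{n/2}` for all `n ∈ ℕ`; and since `N_n = #X(𝔽_{qⁿ}) = qⁿ + 1 - ∑ᵢ αᵢⁿ`,
**Corollary 2**: iff `|N_n - (qⁿ + 1)| ≤ 2g q^{n/2}` for all `n ≥ 1`.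

The statement is purely about the finite family `(αᵢ)`; we prove it for an arbitrary finite family
`α : ι → ℂ` and real `q > 0` under the single hypothesis `∏ᵢ αᵢ = q^g`, `card ι = 2g` (which is
`a_{2g} = q^g`), exactly as the printed proof uses it — so it applies verbatim to the "fake"
`L`-polynomials (integer `aᵢ` satisfying the functional equation but violating the Weil bound) that
serve as negative controls, as well as to genuine curves (where both sides hold by Weil's theorem).

## Main statements

* `OmarBouanani2010.norm_le_one_of_norm_sum_pow_le` — if `‖∑ᵢ βᵢⁿ‖ ≤ C` for all `n` then every
  `‖βᵢ‖ ≤ 1` (the step "the radius of convergence of `log L` is `≥ q^{-1/2}`, hence `|αᵢ| ≤ q^{1/2}`"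
  of the printed proof; here proved by Lagrange interpolation on the distinct values instead of
  power-series analysis — see "Proof" below).
* `OmarBouanani2010.norm_eq_sqrt_iff` — general-cardinality form: `‖∏ αᵢ‖ = q^{card ι/2}` ⟹
  (`∀ i, ‖αᵢ‖ = √q` ⟺ `∀ n, ‖∑ αᵢⁿ‖ ≤ card ι · √qⁿ`).
* `OmarBouanani2010.thm2` — Theorem 2 as printed (`card ι = 2g`, `∏ αᵢ = q^g`).
* `OmarBouanani2010.thm2_sq` — the same with squared (rational) sides
  `‖∑ αᵢⁿ‖² ≤ 4g² qⁿ`, the form used for exact integer checking.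
* `OmarBouanani2010.cor2` — Corollary 2 (point counts `N_n = qⁿ + 1 - ∑ αᵢⁿ`).

## Proof

(⇒) is the triangle inequality.  (⇐): put `βᵢ = αᵢ/√q`, so `‖∑ βᵢⁿ‖ ≤ 2g` for all `n`.  For a
value `x` of `β` with multiplicity `m ≥ 1`, let `ℓ = ∑_r c_r X^r` be the Lagrange basis polynomial
of the finite set of values of `β` at the node `x` (`ℓ(x) = 1`, `ℓ(y) = 0` at the other values).
Then `∑_r c_r (∑ᵢ βᵢ^{n+r}) = ∑ᵢ βᵢⁿ ℓ(βᵢ) = m xⁿ`, so `m ‖x‖ⁿ ≤ (∑_r ‖c_r‖) · 2g` is bounded in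
`n`, forcing `‖x‖ ≤ 1`, i.e. `‖αᵢ‖ ≤ √q` for all `i` (the paper obtains this from the radius of
convergence of `∑ λ_K(n) Tⁿ/n = log L(T)`).  Finally `∏ ‖αᵢ‖ = q^g = (√q)^{2g}` with every factor
`≤ √q` forces every factor to equal `√q` (the paper: "using `∏ αᵢ = a_{2g} = q^g` we derive the
result").

## References

* [OmarBouanani2010] S. Omar, S. Bouanani, *Li's criterion and the Riemann hypothesis for function
  fields*, Finite Fields Appl. 16 (2010) 477–485, doi:10.1016/j.ffa.2010.09.004 — §2 eqs. (4)–(7),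
  Theorem 2 and its proof (pp. 482–483), Corollary 2 (p. 483) (read at page, open-archive copy).

## Mathlib / tree search

No `L`-polynomial RH criterion in Mathlib or the tree (`lean search "2g q|power sum.*Weil|Li's
criterion"`, 2026-08-20).  Related tree file (same technique, Lagrange interpolation against
geometric progressions): `Literature.NumberTheory.LFunctions.FrobeniusMultiset.*`
(`FrobeniusEigenvalueMultiset.lean`).  Mathlib used: `Lagrange.basis`, `Lagrange.eval_basis_self`,
`Lagrange.eval_basis_of_ne`, `Polynomial.eval_eq_sum_range`, `tendsto_pow_atTop_atTop_of_one_lt`.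
-/

open Finset Polynomial Filter

namespace Literature.NumberTheory.LFunctions

namespace OmarBouanani2010

/-! ## Bounded power sums force the points into the closed unit disc -/

/-- **Bounded power sums.** If `β₁, …, β_m ∈ ℂ` satisfy `‖∑ᵢ βᵢⁿ‖ ≤ C` for every `n ∈ ℕ`, then
`‖βᵢ‖ ≤ 1` for every `i`.  (The step `R ≥ q^{-1/2} ⟹ |αᵢ| ≤ q^{1/2}` in the proof of
[OmarBouanani2010, Thm 2], there via the radius of convergence of `log L(T)`; proved here by
Lagrange interpolation.) [cite: OmarBouanani2010, Thm 2 (proof, p. 483)] -/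
theorem norm_le_one_of_norm_sum_pow_le {ι : Type*} [Fintype ι] (β : ι → ℂ) {C : ℝ}
    (hC : ∀ n : ℕ, ‖∑ i, β i ^ n‖ ≤ C) (i₀ : ι) : ‖β i₀‖ ≤ 1 := by
  classical
  set s : Finset ℂ := Finset.univ.image β with hs
  set x : ℂ := β i₀ with hx
  have hxs : x ∈ s := Finset.mem_image_of_mem β (Finset.mem_univ i₀)
  have hβs : ∀ i, β i ∈ s := fun i => Finset.mem_image_of_mem β (Finset.mem_univ i)
  -- the Lagrange basis polynomial of the node set `s` at the node `x`
  set ℓ : ℂ[X] := Lagrange.basis s id x with hℓ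
  have hℓx : ℓ.eval x = 1 := Lagrange.eval_basis_self (v := id) (Set.injOn_id _) hxs
  have hℓy : ∀ y ∈ s, y ≠ x → ℓ.eval y = 0 := fun y hy hyx =>
    Lagrange.eval_basis_of_ne (v := id) (Ne.symm hyx) hy
  -- multiplicity of the value `x`
  set m : ℕ := (Finset.univ.filter fun i => β i = x).card with hm
  have hm1 : 1 ≤ m := Finset.card_pos.2 ⟨i₀, by simp [hx]⟩
  set D : ℕ := ℓ.natDegree + 1 with hD
  -- pairing the power sums against the coefficients of `ℓ` isolates `m xⁿ`
  have key : ∀ n : ℕ,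
      ∑ r ∈ Finset.range D, ℓ.coeff r * ∑ i, β i ^ (n + r) = (m : ℂ) * x ^ n := by
    intro n
    have h1 : ∑ r ∈ Finset.range D, ℓ.coeff r * ∑ i, β i ^ (n + r) =
        ∑ i, β i ^ n * ℓ.eval (β i) := by
      simp_rw [Polynomial.eval_eq_sum_range, Finset.mul_sum]
      rw [Finset.sum_comm]
      refine Finset.sum_congr rfl fun i _ => Finset.sum_congr rfl fun r _ => ?_
      ring
    rw [h1, ← Finset.sum_filter_add_sum_filter_not Finset.univ (fun i => β i = x)]
    have h2 : ∑ i ∈ Finset.univ.filter (fun i => β i = x), β i ^ n * ℓ.eval (β i) =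
        (m : ℂ) * x ^ n := by
      rw [Finset.sum_congr rfl (g := fun _ => x ^ n), Finset.sum_const, nsmul_eq_mul]
      intro i hi
      rw [(Finset.mem_filter.1 hi).2, hℓx, mul_one]
    have h3 : ∑ i ∈ Finset.univ.filter (fun i => ¬ β i = x), β i ^ n * ℓ.eval (β i) = 0 := by
      refine Finset.sum_eq_zero fun i hi => ?_
      rw [hℓy (β i) (hβs i) (Finset.mem_filter.1 hi).2, mul_zero]
    rw [h2, h3, add_zero]
  -- hence `m ‖x‖ⁿ ≤ K` uniformly in `n`
  set K : ℝ := ∑ r ∈ Finset.range D, ‖ℓ.coeff r‖ * C with hK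
  have hbound : ∀ n : ℕ, ‖x‖ ^ n ≤ K := by
    intro n
    have h1 : (m : ℝ) * ‖x‖ ^ n ≤ K := by
      have : ‖(m : ℂ) * x ^ n‖ = (m : ℝ) * ‖x‖ ^ n := by
        rw [norm_mul, norm_pow, Complex.norm_natCast]
      rw [← this, ← key n]
      refine (norm_sum_le _ _).trans (Finset.sum_le_sum fun r _ => ?_)
      rw [norm_mul]
      exact mul_le_mul_of_nonneg_left (hC (n + r)) (norm_nonneg _)
    have h2 : ‖x‖ ^ n ≤ (m : ℝ) * ‖x‖ ^ n := by
      have : (1 : ℝ) ≤ m := by exact_mod_cast hm1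
      nlinarith [pow_nonneg (norm_nonneg x) n]
    exact h2.trans h1
  -- so `‖x‖ ≤ 1`
  by_contra hgt
  rw [not_le] at hgt
  obtain ⟨n, hn⟩ := ((tendsto_pow_atTop_atTop_of_one_lt hgt).eventually_gt_atTop K).exists
  exact absurd (hbound n) (not_le.2 hn)

/-! ## The criterion -/

/-- If nonnegative reals `tᵢ ≤ c` have product `∏ tᵢ = c^{card}` with `c > 0`, then every
`tᵢ = c`. [cite: OmarBouanani2010, Thm 2 (proof, last step, p. 483)] -/
theorem eq_of_prod_eq_pow_of_le {ι : Type*} [Fintype ι] {c : ℝ} (hc : 0 < c) (t : ι → ℝ)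
    (ht0 : ∀ i, 0 ≤ t i) (htc : ∀ i, t i ≤ c) (hprod : ∏ i, t i = c ^ Fintype.card ι) (i : ι) :
    t i = c := by
  classical
  by_contra hne
  have hlt : t i < c := lt_of_le_of_ne (htc i) hne
  have hcard : 1 ≤ Fintype.card ι := Fintype.card_pos_iff.2 ⟨i⟩
  have key : ∏ j, t j < c ^ Fintype.card ι := by
    calc ∏ j, t j = t i * ∏ j ∈ Finset.univ.erase i, t j :=
          (Finset.mul_prod_erase Finset.univ t (Finset.mem_univ i)).symm
      _ ≤ t i * ∏ j ∈ Finset.univ.erase i, c := by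
          refine mul_le_mul_of_nonneg_left ?_ (ht0 i)
          exact Finset.prod_le_prod (fun j _ => ht0 j) fun j _ => htc j
      _ = t i * c ^ (Fintype.card ι - 1) := by
          rw [Finset.prod_const, Finset.card_erase_of_mem (Finset.mem_univ i), Finset.card_univ]
      _ < c * c ^ (Fintype.card ι - 1) :=
          mul_lt_mul_of_pos_right hlt (pow_pos hc _)
      _ = c ^ Fintype.card ι := by
          rw [← pow_succ', Nat.sub_add_cancel hcard]
  exact absurd hprod (ne_of_lt key)

/-- **Omar–Bouanani's criterion, general-cardinality form.** For `q > 0` and a finite family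
`α : ι → ℂ` with `‖∏ᵢ αᵢ‖ = (√q)^{card ι}`: every `‖αᵢ‖ = √q` iff `‖∑ᵢ αᵢⁿ‖ ≤ card ι · (√q)ⁿ` for
all `n ∈ ℕ`. [cite: OmarBouanani2010, Thm 2] -/
theorem norm_eq_sqrt_iff {ι : Type*} [Fintype ι] {q : ℝ} (hq : 0 < q) (α : ι → ℂ)
    (hprod : ‖∏ i, α i‖ = Real.sqrt q ^ Fintype.card ι) :
    (∀ i, ‖α i‖ = Real.sqrt q) ↔
      ∀ n : ℕ, ‖∑ i, α i ^ n‖ ≤ Fintype.card ι * Real.sqrt q ^ n := by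
  have hc : 0 < Real.sqrt q := Real.sqrt_pos.2 hq
  constructor
  · intro h n
    calc ‖∑ i, α i ^ n‖ ≤ ∑ i, ‖α i ^ n‖ := norm_sum_le _ _
      _ = ∑ _i : ι, Real.sqrt q ^ n := Finset.sum_congr rfl fun i _ => by rw [norm_pow, h i]
      _ = Fintype.card ι * Real.sqrt q ^ n := by
          rw [Finset.sum_const, nsmul_eq_mul, Finset.card_univ]
  · intro h
    -- every `‖αᵢ‖ ≤ √q`, by the bounded-power-sums lemma applied to `αᵢ/√q`
    have hle : ∀ i, ‖α i‖ ≤ Real.sqrt q := by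
      intro i
      have hb := norm_le_one_of_norm_sum_pow_le (fun j => α j / (Real.sqrt q : ℂ))
        (C := Fintype.card ι) ?_ i
      · rw [norm_div, Complex.norm_real, Real.norm_eq_abs, abs_of_pos hc, div_le_iff₀ hc,
          one_mul] at hb
        exact hb
      · intro n
        have hs : ∑ j, (α j / (Real.sqrt q : ℂ)) ^ n = (∑ j, α j ^ n) / (Real.sqrt q : ℂ) ^ n := by
          rw [Finset.sum_div]
          exact Finset.sum_congr rfl fun j _ => by rw [div_pow]
        simp only [hs]
        rw [norm_div, norm_pow, Complex.norm_real, Real.norm_eq_abs, abs_of_pos hc,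
          div_le_iff₀ (pow_pos hc n)]
        exact h n
    -- and the product forces equality
    have hprod' : ∏ i, ‖α i‖ = Real.sqrt q ^ Fintype.card ι := by
      rw [← hprod, norm_prod]
    exact eq_of_prod_eq_pow_of_le hc (fun i => ‖α i‖) (fun i => norm_nonneg _) hle hprod'

/-- **Omar–Bouanani 2010, Theorem 2.** Let `q > 0`, `g ∈ ℕ`, and let `α₁, …, α_{2g} ∈ ℂ` be the
inverse roots of `L(T) = ∏ᵢ (1 - αᵢ T)` with `∏ᵢ αᵢ = a_{2g} = q^g`.  Then the Riemann Hypothesis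
for `L` (`|αᵢ| = q^{1/2}` for all `i`, i.e. the zeros of `Z_K(q^{-s})` lie on `Re s = 1/2`) holds
iff `|λ_K(n)| = |∑ᵢ αᵢⁿ| ≤ 2g q^{n/2}` for all `n ∈ ℕ`. [cite: OmarBouanani2010, Thm 2] -/
theorem thm2 {ι : Type*} [Fintype ι] {q : ℝ} (hq : 0 < q) {g : ℕ} (hcard : Fintype.card ι = 2 * g)
    (α : ι → ℂ) (hprod : ∏ i, α i = (q : ℂ) ^ g) :
    (∀ i, ‖α i‖ = Real.sqrt q) ↔ ∀ n : ℕ, ‖∑ i, α i ^ n‖ ≤ 2 * g * Real.sqrt q ^ n := by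
  have hprod' : ‖∏ i, α i‖ = Real.sqrt q ^ Fintype.card ι := by
    rw [hprod, norm_pow, Complex.norm_real, Real.norm_eq_abs, abs_of_pos hq, hcard, pow_mul,
      Real.sq_sqrt hq.le]
  rw [norm_eq_sqrt_iff hq α hprod', hcard]
  push_cast
  exact Iff.rfl

/-- Theorem 2 with both sides squared — the rational form `‖∑ᵢ αᵢⁿ‖² ≤ 4g² qⁿ` used for exact
checking when the power sums are integers. [cite: OmarBouanani2010, Thm 2] -/
theorem thm2_sq {ι : Type*} [Fintype ι] {q : ℝ} (hq : 0 < q) {g : ℕ} (hcard : Fintype.card ι = 2 * g)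
    (α : ι → ℂ) (hprod : ∏ i, α i = (q : ℂ) ^ g) :
    (∀ i, ‖α i‖ = Real.sqrt q) ↔ ∀ n : ℕ, ‖∑ i, α i ^ n‖ ^ 2 ≤ 4 * (g : ℝ) ^ 2 * q ^ n := by
  rw [thm2 hq hcard α hprod]
  have hc : 0 ≤ Real.sqrt q := Real.sqrt_nonneg q
  have hsq : ∀ n : ℕ, (2 * (g : ℝ) * Real.sqrt q ^ n) ^ 2 = 4 * (g : ℝ) ^ 2 * q ^ n := by
    intro n
    rw [mul_pow, mul_pow, ← pow_mul, mul_comm n 2, pow_mul, Real.sq_sqrt hq.le]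
    ring
  refine forall_congr' fun n => ⟨fun h => ?_, fun h => ?_⟩
  · rw [← hsq n]
    exact pow_le_pow_left₀ (norm_nonneg _) h 2
  · have h2 : (0 : ℝ) ≤ 2 * (g : ℝ) * Real.sqrt q ^ n := by positivity
    rw [← hsq n] at h
    calc ‖∑ i, α i ^ n‖ = Real.sqrt (‖∑ i, α i ^ n‖ ^ 2) := (Real.sqrt_sq (norm_nonneg _)).symm
      _ ≤ Real.sqrt ((2 * (g : ℝ) * Real.sqrt q ^ n) ^ 2) := Real.sqrt_le_sqrt h
      _ = 2 * (g : ℝ) * Real.sqrt q ^ n := Real.sqrt_sq h2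

/-- **Omar–Bouanani 2010, Corollary 2.** With `N_n = qⁿ + 1 - ∑ᵢ αᵢⁿ` (the number of
`𝔽_{qⁿ}`-rational points of the curve, eq. (14)): RH for `L` iff `|N_n - (qⁿ + 1)| ≤ 2g q^{n/2}`
for all `n`. [cite: OmarBouanani2010, Cor 2] -/
theorem cor2 {ι : Type*} [Fintype ι] {q : ℝ} (hq : 0 < q) {g : ℕ} (hcard : Fintype.card ι = 2 * g)
    (α : ι → ℂ) (hprod : ∏ i, α i = (q : ℂ) ^ g) (N : ℕ → ℂ)
    (hN : ∀ n, N n = (q : ℂ) ^ n + 1 - ∑ i, α i ^ n) :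
    (∀ i, ‖α i‖ = Real.sqrt q) ↔ ∀ n : ℕ, ‖N n - ((q : ℂ) ^ n + 1)‖ ≤ 2 * g * Real.sqrt q ^ n := by
  rw [thm2 hq hcard α hprod]
  refine forall_congr' fun n => ?_
  rw [hN n, show (q : ℂ) ^ n + 1 - ∑ i, α i ^ n - ((q : ℂ) ^ n + 1) = -∑ i, α i ^ n by ring,
    norm_neg]

end OmarBouanani2010

end Literature.NumberTheory.LFunctions
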